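import Summits.NavierStokesRegularity.NavierStokesRegularity.Theorems.ArgmaxDoorsPenalisedGrowth
import Summits.NavierStokesRegularity.NavierStokesRegularity.Theorems.ArgmaxDoorsDefs
import Literature.Analysis.FluidPDE.ClassicalSolutionGlue
import Literature.Analysis.FluidPDE.CurlFreeLiouville
import HarnessLib

/-!
# ArgmaxDoorsAncient — the ANCIENT ARGMAX LAW: the reduction of nsreg-p1 g29's seed σ1, PROVED
# («Type-I ancient + bounded velocity + subcritical twist-credited rate at almost-argmaxima ⇒ ω ≡ 0»)

The S35 argmax engine run BACKWARD-GLOBALLY on an ancient profile. No decay and no Sobolev class are assumed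
(the bounded-frame engine `ArgmaxDoorsPenalisedGrowth.norm_curl_le_mul_exp_of_almostArgmax_rate_le`, built on
the penalised comparison `ArgmaxDoorsAlmostArgmax`): on a backward slab `[s₁,s₂] ⊂ (−∞,0)` with `|u| ≤ U`,
Type-I vorticity `|ω(s)| ≤ C/(−s)` and the rate hypothesis `α − ν|∇ξ|²_F ≤ a/(−s)` at `(1−δ)`-almost
argmaxima, `|ω(s₂)| ≤ C(−s₁)^{a−1}(−s₂)^{−a}`; for `a < 1` the right side tends to `0` as `s₁ → −∞`.

* `norm_curl_le_of_ancient_slab` — the one-slab bound;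
* `curl_eq_zero_of_ancient_typeI_of_almostArgmax_rate` — `ω ≡ 0` on `(−∞,0) × ℝ³`.

HONEST FRAME / WHAT THIS IS NOT: a CONDITIONAL Liouville statement — the research stub «why a wall profile
(W3 26991 one-signed / H2 10661 Type-I ancient) should have a subcritical almost-argmax rate» is OPEN and
nothing about those cruxes is proved; item 0056 `NoTypeII` and NS regularity are NOT proved; no Literature
fact is taken as a hypothesis; `--supports stmt-NavierStokesRegularity-0056 --as helper` (S-door lane tools,
LEAD ns-s30-p1 g3; nsreg-p1 g29 HANDOFF seed σ1 «ancient argmax law», to be filed by the planner as a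
wall-facing idea/line, not as a door).
-/

noncomputable section

set_option linter.dupNamespace false

open MeasureTheory Set Function Filter Metric Real InnerProductSpace
open _root_.Topology
open scoped ENNReal NNReal RealInnerProductSpace ContDiff Laplacian
open Literature.Analysis Literature.Analysis.FluidPDE
open Literature.Analysis.FluidPDE.VorticityDirectionDynamics

namespace Summit.NavierStokesRegularity.NavierStokesRegularity.Theorems.ArgmaxDoors

-- nested operator types (second derivatives)
set_option maxSynthPendingDepth 3

/-- **Ancient argmax law — one backward slab.** Let `(u,p)` be a classical unforced Navier–Stokes solution
(`ν > 0`) on a compact backward slab `[s₁,s₂]`, `s₁ < s₂ < 0`, with `|u| ≤ U` and Type-I vorticity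
`|ω(s,x)| ≤ C/(−s)` there, and suppose that at every `s ∈ (s₁,s₂]` and every `(1−δ)`-almost argmax `x̄` of
`|ω(s,·)|` with `ω(s,x̄) ≠ 0` the twist-credited rate obeys `α − ν|∇ξ|²_F ≤ a/(−s)`. Then
`|ω(s₂,x)| ≤ C(−s₁)^{a−1}(−s₂)^{−a}` for all `x` (the bounded-frame engine
`norm_curl_le_mul_exp_of_almostArgmax_rate_le` with `Φ(t) = −a log(−s₁ − t)`, time-translated).
[folklore] -/
theorem norm_curl_le_of_ancient_slab {ν U C a δ s₁ s₂ : ℝ} (hν : 0 < ν) (hδ : 0 < δ)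
    (h₁₂ : s₁ < s₂) (hs₂ : s₂ < 0)
    {u : ℝ → (EuclideanSpace ℝ (Fin 3)) → (EuclideanSpace ℝ (Fin 3))}
    {p : ℝ → (EuclideanSpace ℝ (Fin 3)) → ℝ} (hS : IsClassicalNSSolutionOn (Icc s₁ s₂) ν 0 u p)
    (hU : ∀ s ∈ Icc s₁ s₂, ∀ x, ‖u s x‖ ≤ U)
    (hTypeI : ∀ s ∈ Icc s₁ s₂, ∀ x, ‖curl (u s) x‖ ≤ C / (-s))
    (hrate : ∀ s ∈ Ioc s₁ s₂, ∀ x₀ : EuclideanSpace ℝ (Fin 3),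
      (∀ x, (1 - δ) * ‖curl (u s) x‖ ≤ ‖curl (u s) x₀‖) → curl (u s) x₀ ≠ 0 →
      ⟪vorticityDirection (curl (u s)) x₀, fderiv ℝ (u s) x₀ (vorticityDirection (curl (u s)) x₀)⟫ -
          ν * frobeniusNormSq (fderiv ℝ (vorticityDirection (curl (u s))) x₀) ≤ a / (-s)) :
    ∀ x, ‖curl (u s₂) x‖ ≤ C * (-s₁) ^ (a - 1) * (-s₂) ^ (-a) := by
  -- translate to `[0, L]`, `L = s₂ − s₁`
  set L : ℝ := s₂ - s₁ with hL
  have hLpos : 0 < L := by rw [hL]; linarith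
  set T : ℝ := -s₁ with hT
  have hLT : L < T := by rw [hL, hT]; linarith
  set v : ℝ → (EuclideanSpace ℝ (Fin 3)) → (EuclideanSpace ℝ (Fin 3)) := fun t => u (t + s₁) with hv
  set q : ℝ → (EuclideanSpace ℝ (Fin 3)) → ℝ := fun t => p (t + s₁) with hq
  have hmem : ∀ t ∈ Icc 0 L, t + s₁ ∈ Icc s₁ s₂ := fun t ht =>
    ⟨by linarith [ht.1], by rw [hL] at ht; linarith [ht.2]⟩
  have hS' : IsClassicalNSSolutionOn (Icc 0 L) ν 0 v q := by
    have h := hS.comp_add_right s₁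
    refine h.mono (fun t ht => ?_) (uniqueDiffOn_Icc hLpos)
    exact hmem t ht
  have hU' : ∀ t ∈ Icc 0 L, ∀ x, ‖v t x‖ ≤ U := fun t ht x => hU (t + s₁) (hmem t ht) x
  have hs₂' : ∀ t ∈ Icc 0 L, 0 < -(t + s₁) := fun t ht => by
    have := (hmem t ht).2; linarith
  have hK' : ∀ t ∈ Icc 0 L, ∀ x, ‖curl (v t) x‖ ≤ C / (-s₂) := by
    intro t ht x
    have h1 := hTypeI (t + s₁) (hmem t ht) x
    have hC0 : 0 ≤ C := by
      have h2 : 0 ≤ C / (-(t + s₁)) := (norm_nonneg _).trans h1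
      exact (div_nonneg_iff.1 h2).elim (fun h => h.1) fun h => by linarith [hs₂' t ht, h.2]
    refine h1.trans (div_le_div_of_nonneg_left hC0 (by linarith) ?_)
    linarith [(hmem t ht).2]
  -- the integrating factor `Φ(t) = −a log(T − t)`, `T = −s₁`
  have hΦc : ContinuousOn (fun t => -a * Real.log (T - t)) (Icc 0 L) := fun t ht =>
    (hasDerivAt_neg_mul_log_sub a (lt_of_le_of_lt ht.2 hLT)).continuousAt.continuousWithinAt
  have hΦd : ∀ t ∈ Icc 0 L,
      HasDerivWithinAt (fun r => -a * Real.log (T - r)) (a / (T - t)) (Icc 0 L) t := fun t ht =>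
    (hasDerivAt_neg_mul_log_sub a (lt_of_le_of_lt ht.2 hLT)).hasDerivWithinAt
  have hrate' : ∀ t ∈ Icc 0 L, 0 < t → ∀ x₀ : EuclideanSpace ℝ (Fin 3),
      (∀ x, (1 - δ) * ‖curl (v t) x‖ ≤ ‖curl (v t) x₀‖) → curl (v t) x₀ ≠ 0 →
      ⟪vorticityDirection (curl (v t)) x₀, fderiv ℝ (v t) x₀ (vorticityDirection (curl (v t)) x₀)⟫ -
          ν * frobeniusNormSq (fderiv ℝ (vorticityDirection (curl (v t))) x₀) ≤ a / (T - t) := by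
    intro t ht htpos x₀ halmost hne
    have h := hrate (t + s₁) ⟨by linarith, (hmem t ht).2⟩ x₀ halmost hne
    have hTt : -(t + s₁) = T - t := by rw [hT]; ring
    rw [hTt] at h
    exact h
  have hM : ∀ x, ‖curl (v 0) x‖ ≤ C / (-s₁) := fun x => by
    have h := hTypeI s₁ ⟨le_rfl, h₁₂.le⟩ x
    simpa [hv] using h
  have hmain := norm_curl_le_mul_exp_of_almostArgmax_rate_le hν hLpos hδ hS' hU' hK' hΦc hΦd hrate' hM
  intro x
  have h := hmain L ⟨hLpos.le, le_rfl⟩ x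
  have hvL : v L = u s₂ := by simp [hv, hL]
  rw [hvL, exp_neg_mul_log_sub_sub a hLpos.le hLT] at h
  -- `C/(−s₁) · ((T − 0)/(T − L))^a = C (−s₁)^{a−1} (−s₂)^{−a}`
  have hT0 : T - 0 = -s₁ := by rw [hT]; ring
  have hTL : T - L = -s₂ := by rw [hT, hL]; ring
  rw [hT0, hTL] at h
  have hs₁pos : 0 < -s₁ := by linarith
  have hs₂pos : 0 < -s₂ := by linarith
  have hid : C / (-s₁) * ((-s₁) / (-s₂)) ^ a = C * (-s₁) ^ (a - 1) * (-s₂) ^ (-a) := by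
    rw [Real.div_rpow hs₁pos.le hs₂pos.le, Real.rpow_sub hs₁pos, Real.rpow_one, Real.rpow_neg hs₂pos.le]
    field_simp
  rw [hid] at h
  exact h

/-- **ANCIENT ARGMAX LAW (the reduction of nsreg-p1 g29's seed σ1, PROVED).** Let `(u,p)` be a classical
unforced Navier–Stokes solution (`ν > 0`) on every compact backward slab `[s₁,s₂] ⊂ (−∞,0)`, with bounded
velocity `|u| ≤ U` and TYPE-I vorticity `|ω(s,x)| ≤ C/(−s)` for `s < 0`. If at every time `s < 0` and every
`(1−δ)`-almost argmax `x̄` of `|ω(s,·)|` (`δ > 0` fixed) with `ω(s,x̄) ≠ 0` the twist-credited stretching rate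
is SUBCRITICAL, `α(s,x̄) − ν|∇ξ(s,x̄)|²_F ≤ a/(−s)` with `a < 1`, then `ω ≡ 0` on `(−∞,0) × ℝ³`. Proof:
`|ω(s₂,·)| ≤ C(−s₁)^{a−1}(−s₂)^{−a} → 0` as `s₁ → −∞`. The hypothesis is vacuous for no solution (almost
argmaxima always exist for a bounded non-zero slice); WHY a wall profile should satisfy it is the open research
stub — nothing about the walls is proved here. [folklore] -/
theorem curl_eq_zero_of_ancient_typeI_of_almostArgmax_rate {ν U C a δ : ℝ} (hν : 0 < ν) (ha : a < 1)
    (hδ : 0 < δ) {u : ℝ → (EuclideanSpace ℝ (Fin 3)) → (EuclideanSpace ℝ (Fin 3))}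
    {p : ℝ → (EuclideanSpace ℝ (Fin 3)) → ℝ}
    (hS : ∀ s₁ s₂ : ℝ, s₁ < s₂ → s₂ < 0 → IsClassicalNSSolutionOn (Icc s₁ s₂) ν 0 u p)
    (hU : ∀ s : ℝ, s < 0 → ∀ x, ‖u s x‖ ≤ U)
    (hTypeI : ∀ s : ℝ, s < 0 → ∀ x, ‖curl (u s) x‖ ≤ C / (-s))
    (hrate : ∀ s : ℝ, s < 0 → ∀ x₀ : EuclideanSpace ℝ (Fin 3),
      (∀ x, (1 - δ) * ‖curl (u s) x‖ ≤ ‖curl (u s) x₀‖) → curl (u s) x₀ ≠ 0 →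
      ⟪vorticityDirection (curl (u s)) x₀, fderiv ℝ (u s) x₀ (vorticityDirection (curl (u s)) x₀)⟫ -
          ν * frobeniusNormSq (fderiv ℝ (vorticityDirection (curl (u s))) x₀) ≤ a / (-s)) :
    ∀ s : ℝ, s < 0 → ∀ x, curl (u s) x = 0 := by
  intro s hs x
  have hspos : 0 < -s := by linarith
  -- `‖ω(s,x)‖ ≤ C (−s)^{−a} · (−s₁)^{a−1}` for every `s₁ < s`
  have hbound : ∀ s₁ : ℝ, s₁ < s → ‖curl (u s) x‖ ≤ C * (-s₁) ^ (a - 1) * (-s) ^ (-a) := by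
    intro s₁ hs₁
    exact norm_curl_le_of_ancient_slab hν hδ hs₁ hs (hS s₁ s hs₁ hs)
      (fun r hr y => hU r (lt_of_le_of_lt hr.2 hs) y)
      (fun r hr y => hTypeI r (lt_of_le_of_lt hr.2 hs) y)
      (fun r hr y hy hy0 => hrate r (lt_of_le_of_lt hr.2 hs) y hy hy0) x
  -- `C ≥ 0` (from the Type-I bound at `s`) and `(−s₁)^{a−1} → 0`
  have hC0 : 0 ≤ C := by
    have h2 : 0 ≤ C / (-s) := (norm_nonneg _).trans (hTypeI s hs x)
    exact (div_nonneg_iff.1 h2).elim (fun h => h.1) fun h => by linarith [h.2]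
  have hlim : Tendsto (fun y : ℝ => C * y ^ (a - 1) * (-s) ^ (-a)) atTop (𝓝 0) := by
    have h1 : Tendsto (fun y : ℝ => y ^ (-(1 - a))) atTop (𝓝 0) := tendsto_rpow_neg_atTop (by linarith)
    have h2 : Tendsto (fun y : ℝ => C * y ^ (-(1 - a)) * (-s) ^ (-a)) atTop (𝓝 (C * 0 * (-s) ^ (-a))) :=
      (h1.const_mul C).mul_const _
    rw [mul_zero, zero_mul] at h2
    refine h2.congr fun y => ?_
    rw [show -(1 - a) = a - 1 by ring]
  have hle0 : ‖curl (u s) x‖ ≤ 0 := by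
    refine le_of_forall_pos_lt_add fun η hη => ?_
    have hev : ∀ᶠ y : ℝ in atTop, C * y ^ (a - 1) * (-s) ^ (-a) < η :=
      (hlim.eventually (gt_mem_nhds hη))
    obtain ⟨y, hy, hy1⟩ := (hev.and (eventually_gt_atTop (-s))).exists
    have hs₁ : -y < s := by linarith
    have h := hbound (-y) hs₁
    rw [neg_neg] at h
    linarith
  exact norm_le_zero_iff.1 hle0

/-- **Ancient argmax law, Liouville form (APPEND).** Under the hypotheses of
`curl_eq_zero_of_ancient_typeI_of_almostArgmax_rate`, every backward slice of the velocity is SPATIALLY CONSTANT: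
`u(s,x) = u(s,y)` for all `s < 0`, `x, y` (`curl u(s) = 0`, `div u(s) = 0`, `|u(s)| ≤ U` ⇒ harmonic and bounded
⇒ constant, tree `eq_of_curl_eq_zero_of_isDivFree_of_bounded`). A conditional KNSS-type Liouville statement; the
rate hypothesis at almost-argmaxima is the open research stub — nothing about the walls is proved. [folklore] -/
theorem velocity_const_of_ancient_typeI_of_almostArgmax_rate {ν U C a δ : ℝ} (hν : 0 < ν) (ha : a < 1)
    (hδ : 0 < δ) {u : ℝ → (EuclideanSpace ℝ (Fin 3)) → (EuclideanSpace ℝ (Fin 3))}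
    {p : ℝ → (EuclideanSpace ℝ (Fin 3)) → ℝ}
    (hS : ∀ s₁ s₂ : ℝ, s₁ < s₂ → s₂ < 0 → IsClassicalNSSolutionOn (Icc s₁ s₂) ν 0 u p)
    (hU : ∀ s : ℝ, s < 0 → ∀ x, ‖u s x‖ ≤ U)
    (hTypeI : ∀ s : ℝ, s < 0 → ∀ x, ‖curl (u s) x‖ ≤ C / (-s))
    (hrate : ∀ s : ℝ, s < 0 → ∀ x₀ : EuclideanSpace ℝ (Fin 3),
      (∀ x, (1 - δ) * ‖curl (u s) x‖ ≤ ‖curl (u s) x₀‖) → curl (u s) x₀ ≠ 0 →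
      ⟪vorticityDirection (curl (u s)) x₀, fderiv ℝ (u s) x₀ (vorticityDirection (curl (u s)) x₀)⟫ -
          ν * frobeniusNormSq (fderiv ℝ (vorticityDirection (curl (u s))) x₀) ≤ a / (-s)) :
    ∀ s : ℝ, s < 0 → ∀ x y, u s x = u s y := by
  intro s hs x y
  have hcurl := curl_eq_zero_of_ancient_typeI_of_almostArgmax_rate hν ha hδ hS hU hTypeI hrate s hs
  have hsol := hS (s - 1) s (by linarith) hs
  have hmem : s ∈ Icc (s - 1) s := ⟨by linarith, le_rfl⟩
  have hv : ContDiff ℝ 2 (u s) := (hsol.contDiff_velocity hmem).of_le (by norm_cast)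
  exact eq_of_curl_eq_zero_of_isDivFree_of_bounded hv hcurl (hsol.divFree s hmem) (hU s hs) x y

end Summit.NavierStokesRegularity.NavierStokesRegularity.Theorems.ArgmaxDoors

end
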